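import Mathlib.GroupTheory.GroupAction.Quotient
import Mathlib.GroupTheory.Index
import Literature.AnabelianGeometry.Anabelioids.FreeFibres
import Literature.AnabelianGeometry.SemiGraphs.GaloisCountableOfStrictlyCoherent

/-!
# Finite `G`-sets with one and the same point stabiliser ("uniform" `G`-sets)

Mathlib-level lemmas for the anabelioid dictionary ([SGA1, Exp. V §4–5] as used in Mochizuki,
*Semi-graphs of anabelioids*, Publ. RIMS **42** (2006), §2, proofs of Prop. 2.5 / Prop. 2.6, author's
manuscript pp. 27–29: the finite étale coverings GLUED from "`M/[Π_v : N]` copies of the covering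
defined by the `Π_v`-set `Π_v/N`" — gluing along a branch is possible exactly when the two edge
objects have isomorphic fibres as `Π_e`-sets) [cite: MochizukiSemiAnbd2006, Prop. 2.6 p.28]:

* `exists_equivariant_equiv_of_stabilizer_eq` — two finite `G`-sets of the same cardinality all of
  whose point stabilisers are ONE subgroup `K` are `G`-equivariantly in bijection (both are disjoint
  unions of copies of `G/K`);
* `nonempty_iso_of_stabilizer_eq` — hence two objects of a connected anabelioid with such fibres
  (same cardinality, same uniform stabiliser) are isomorphic;
* `exists_obj_uniform_stabilizer` — for an open normal subgroup `W ⊴ Aut F` of finite index and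
  `k ≥ 1` there is an object whose fibre has `k · [Aut F : W]` points, all with stabiliser `W`
  ("`k` copies of the covering defined by `Π_v/W`").

Proof-only companion (no new notions).  Nothing here takes a side on [IUTchIII] Cor. 3.12.
-/

namespace Literature.AnabelianGeometry.SemiGraphs

open CategoryTheory CategoryTheory.PreGaloisCategory
open Literature.AnabelianGeometry.Anabelioids

universe w v₁ u₁

/-! ### Uniform `G`-sets: the equivariant "coordinates" `Ω × G/K → X` -/

section Uniform

variable {G : Type*} [Group G] (K : Subgroup G) {X : Type*} [MulAction G X]

/-- For a `G`-set all of whose stabilisers are `K` and a point `x`: the "chart" `G/K → X`,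
`gK ↦ g • x` (well defined since `Stab(x) = K`), injective and equivariant.
[cite: MochizukiSemiAnbd2006, Prop. 2.6 p.28] -/
private theorem exists_chart (hX : ∀ x : X, MulAction.stabilizer G x = K) (x : X) :
    ∃ c : G ⧸ K → X, Function.Injective c ∧ (∀ g : G, c (g : G ⧸ K) = g • x) ∧
      ∀ (g : G) (q : G ⧸ K), c (g • q) = g • c q := by
  refine ⟨fun q => Quotient.liftOn' q (fun g => g • x) fun a b hab => ?_, ?_, fun g => rfl, ?_⟩
  · rw [QuotientGroup.leftRel_apply, ← hX x, MulAction.mem_stabilizer_iff, mul_smul,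
      inv_smul_eq_iff] at hab
    exact hab.symm
  · intro q₁ q₂ h
    induction q₁ using QuotientGroup.induction_on with
    | H g₁ =>
      induction q₂ using QuotientGroup.induction_on with
      | H g₂ =>
        change g₁ • x = g₂ • x at h
        apply Quotient.sound'
        rw [QuotientGroup.leftRel_apply, ← hX x, MulAction.mem_stabilizer_iff, mul_smul, ← h,
          inv_smul_smul]
  · intro g q
    induction q using QuotientGroup.induction_on with
    | H h =>
      rw [MulAction.Quotient.smul_mk, smul_eq_mul]
      change (g * h) • x = g • h • x
      rw [mul_smul]

/-- The "coordinate map" `Ω × G/K → X`, `(ω, gK) ↦ g • ω.out` for the orbit space `Ω`: a bijection,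
equivariant for the action on the second factor. [cite: MochizukiSemiAnbd2006, Prop. 2.6 p.28] -/
private theorem exists_coord (hX : ∀ x : X, MulAction.stabilizer G x = K) :
    ∃ f : MulAction.orbitRel.Quotient G X × (G ⧸ K) → X, Function.Bijective f ∧
      ∀ (g : G) (p : MulAction.orbitRel.Quotient G X × (G ⧸ K)), f (p.1, g • p.2) = g • f p := by
  choose c hcinj hcmk hcsmul using exists_chart K hX
  refine ⟨fun p => c p.1.out p.2, ⟨?_, ?_⟩, fun g p => hcsmul _ g p.2⟩
  · rintro ⟨ω₁, q₁⟩ ⟨ω₂, q₂⟩ h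
    change c ω₁.out q₁ = c ω₂.out q₂ at h
    -- same orbit, hence same `ω`; then injectivity of the chart
    have hmem : ∀ (ω : MulAction.orbitRel.Quotient G X) (q : G ⧸ K),
        c ω.out q ∈ MulAction.orbit G ω.out := by
      intro ω q
      induction q using QuotientGroup.induction_on with
      | H g => exact ⟨g, (hcmk _ g).symm⟩
    have hω : ω₁ = ω₂ := by
      have h1 := hmem ω₁ q₁
      have h2 := hmem ω₂ q₂
      rw [h] at h1
      have h12 : MulAction.orbit G ω₁.out = MulAction.orbit G ω₂.out := by
        obtain ⟨g₁, hg₁⟩ := h1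
        obtain ⟨g₂, hg₂⟩ := h2
        dsimp only at hg₁ hg₂
        rw [← MulAction.orbit_smul g₁ ω₁.out, hg₁, ← hg₂, MulAction.orbit_smul]
      rw [← Quotient.out_eq' ω₁, ← Quotient.out_eq' ω₂]
      exact Quotient.sound' (by
        change ω₁.out ∈ MulAction.orbit G ω₂.out
        rw [← h12]; exact MulAction.mem_orbit_self _)
    subst hω
    exact Prod.ext rfl (hcinj _ h)
  · intro x
    let ω : MulAction.orbitRel.Quotient G X := Quotient.mk'' x
    have hx : ω.out ∈ MulAction.orbit G x := Quotient.exact' (Quotient.out_eq' ω)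
    obtain ⟨g, hg⟩ := hx
    refine ⟨(ω, ((g⁻¹ : G) : G ⧸ K)), ?_⟩
    change c ω.out ((g⁻¹ : G) : G ⧸ K) = x
    rw [hcmk, ← hg, inv_smul_smul]

/-- In a uniform `G`-set with a point, `G/K` is finite as soon as `X` is. [folklore] -/
private theorem finite_quotient_of_uniform [Finite X] (hX : ∀ x : X, MulAction.stabilizer G x = K)
    (x : X) : Finite (G ⧸ K) := by
  obtain ⟨c, hc, -, -⟩ := exists_chart K hX x
  exact Finite.of_injective _ hc

/-- **Uniform finite `G`-sets of the same cardinality are equivariantly in bijection.**  If all point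
stabilisers of the finite `G`-sets `X` and `Y` are the subgroup `K` and `|X| = |Y|`, there is a
`G`-equivariant bijection `X ≃ Y`. [cite: MochizukiSemiAnbd2006, Prop. 2.6 p.28] -/
theorem exists_equivariant_equiv_of_stabilizer_eq {Y : Type*} [MulAction G Y] [Finite X] [Finite Y]
    (hX : ∀ x : X, MulAction.stabilizer G x = K) (hY : ∀ y : Y, MulAction.stabilizer G y = K)
    (hcard : Nat.card X = Nat.card Y) :
    ∃ e : X ≃ Y, ∀ (g : G) (x : X), e (g • x) = g • e x := by
  classical
  cases isEmpty_or_nonempty X with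
  | inl hXe =>
    haveI : IsEmpty Y := by
      rw [← not_nonempty_iff, ← Finite.card_pos_iff, ← hcard]
      simp
    exact ⟨Equiv.equivOfIsEmpty X Y, fun _ x => isEmptyElim x⟩
  | inr hXn =>
    obtain ⟨x₀⟩ := hXn
    haveI : Finite (G ⧸ K) := finite_quotient_of_uniform K hX x₀
    -- coordinates on both sides
    obtain ⟨fX, hfX, hfXs⟩ := exists_coord K hX
    obtain ⟨fY, hfY, hfYs⟩ := exists_coord K hY
    let cX := Equiv.ofBijective fX hfX
    let cY := Equiv.ofBijective fY hfY
    have hcX : Nat.card X = Nat.card (MulAction.orbitRel.Quotient G X) * Nat.card (G ⧸ K) := by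
      rw [← Nat.card_prod]; exact (Nat.card_congr cX).symm
    have hcY : Nat.card Y = Nat.card (MulAction.orbitRel.Quotient G Y) * Nat.card (G ⧸ K) := by
      rw [← Nat.card_prod]; exact (Nat.card_congr cY).symm
    have hq : 0 < Nat.card (G ⧸ K) := Nat.card_pos
    have hΩ : Nat.card (MulAction.orbitRel.Quotient G X) =
        Nat.card (MulAction.orbitRel.Quotient G Y) := by
      rw [hcX, hcY] at hcard
      exact Nat.eq_of_mul_eq_mul_right hq hcard
    haveI : Finite (MulAction.orbitRel.Quotient G X) := Quotient.finite _
    haveI : Finite (MulAction.orbitRel.Quotient G Y) := Quotient.finite _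
    obtain ⟨η⟩ : Nonempty (MulAction.orbitRel.Quotient G X ≃ MulAction.orbitRel.Quotient G Y) :=
      Finite.card_eq.mp hΩ
    refine ⟨cX.symm.trans ((η.prodCongr (Equiv.refl _)).trans cY), fun g x => ?_⟩
    -- equivariance: transport through the coordinates
    obtain ⟨p, rfl⟩ := cX.surjective x
    have h1 : cX.symm (g • cX p) = (p.1, g • p.2) := by
      apply cX.injective
      rw [Equiv.apply_symm_apply]
      exact (hfXs g p).symm
    simp only [Equiv.trans_apply, Equiv.symm_apply_apply, h1, Equiv.prodCongr_apply, Prod.map,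
      Equiv.refl_apply]
    exact hfYs g (η p.1, p.2)

end Uniform

/-! ### In a connected anabelioid -/

variable {C : Type u₁} [Category.{v₁} C] [GaloisCategory C] (F : C ⥤ FintypeCat.{w}) [FiberFunctor F]

/-- **Objects with uniform fibres of the same size are isomorphic**: if the fibres `F(X₁)`, `F(X₂)`
have the same cardinality and all their points have one and the same stabiliser `K ⊆ Aut F`, then
`X₁ ≅ X₂` (the gluing isomorphisms of [SemiAnbd] p. 28, "by choosing appropriate gluing
isomorphisms"). [cite: MochizukiSemiAnbd2006, Prop. 2.6 p.28] -/
theorem nonempty_iso_of_stabilizer_eq (K : Subgroup (Aut F)) {X₁ X₂ : C}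
    (h₁ : ∀ x : F.obj X₁, MulAction.stabilizer (Aut F) x = K)
    (h₂ : ∀ x : F.obj X₂, MulAction.stabilizer (Aut F) x = K)
    (hcard : Nat.card (F.obj X₁) = Nat.card (F.obj X₂)) : Nonempty (X₁ ≅ X₂) := by
  obtain ⟨e, he⟩ := exists_equivariant_equiv_of_stabilizer_eq K h₁ h₂ hcard
  exact nonempty_iso_of_equivariant_equiv F e he

/-- **"`k` copies of the covering defined by `Π/W`"**: for an open normal subgroup `W ⊴ Aut F` of
finite index and `k ≥ 1` (any `k`) there is an object whose fibre has `k · [Aut F : W]` points, every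
point having stabiliser exactly `W`. [cite: MochizukiSemiAnbd2006, Prop. 2.6 p.28] -/
theorem exists_obj_uniform_stabilizer {C : Type u₁} [Category.{v₁} C] [GaloisCategory C]
    (F : C ⥤ FintypeCat.{v₁}) [FiberFunctor F] (W : Subgroup (Aut F)) [W.Normal]
    (hWo : IsOpen (W : Set (Aut F))) [W.FiniteIndex] (k : ℕ) :
    ∃ X : C, Nat.card (F.obj X) = k * W.index ∧
      ∀ x : F.obj X, MulAction.stabilizer (Aut F) x = W := by
  classical
  -- the `Aut F`-set `Fin k × (Aut F)/W`, acting on the second factor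
  let Y : Type _ := Fin k × (Aut F ⧸ W)
  letI : MulAction (Aut F) Y :=
    { smul := fun σ p => (p.1, σ • p.2)
      one_smul := fun p => Prod.ext rfl (one_smul _ p.2)
      mul_smul := fun σ τ p => Prod.ext rfl (mul_smul σ τ p.2) }
  have hsmul : ∀ (σ : Aut F) (p : Y), σ • p = (p.1, σ • p.2) := fun _ _ => rfl
  haveI : Finite (Aut F ⧸ W) := Subgroup.finite_quotient_of_finiteIndex
  haveI : Finite Y := Finite.instProd
  have hstab : ∀ p : Y, MulAction.stabilizer (Aut F) p = W := by
    rintro ⟨i, q⟩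
    induction q using QuotientGroup.induction_on with
    | H g =>
      ext σ
      rw [MulAction.mem_stabilizer_iff, hsmul, Prod.mk.injEq]
      simp only [true_and]
      change σ • (g : Aut F ⧸ W) = (g : Aut F ⧸ W) ↔ σ ∈ W
      rw [MulAction.Quotient.smul_mk, smul_eq_mul, QuotientGroup.eq, mul_inv_rev,
        Subgroup.Normal.mem_comm_iff inferInstance, ← mul_assoc, mul_inv_cancel, one_mul, inv_mem_iff]
  have hopen : ∀ p : Y, IsOpen (MulAction.stabilizer (Aut F) p : Set (Aut F)) := fun p => by
    rw [hstab p]; exact hWo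
  obtain ⟨X, e, he⟩ := SemiGraphOfAnabelioids.exists_obj_of_aut_action' F Y hopen
  refine ⟨X, ?_, fun x => ?_⟩
  · rw [Nat.card_congr e, Nat.card_prod, Nat.card_fin, Subgroup.index, Nat.card_congr
      (show Aut F ⧸ W ≃ Aut F ⧸ W from Equiv.refl _)]
  · rw [← hstab (e x)]
    ext σ
    simp only [MulAction.mem_stabilizer_iff, ← he, e.apply_eq_iff_eq]

end Literature.AnabelianGeometry.SemiGraphs
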